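import Literature.AlgebraicGeometry.HodgeTheory.WeilClassesDescendingTransfer
import Literature.AlgebraicGeometry.Motives.AbelianVarietyCohomologyExteriorH1
import HarnessLib

/-!
# Schoen's transfer from Lefschetz `(1,1)` alone: the two Weil lines pair perfectly (`E₊ ⌣ E₋ ≠ 0`)

Family `hodge`, layer `Literature/AlgebraicGeometry/HodgeTheory`. Second sibling PROOF file of
`WeilClassesDescending` (after `WeilClassesDescendingProofs`, the partner-surface half, and
`WeilClassesDescendingTransfer`, Schoen's transfer on the carriers), for the named fact
`Schoen1998_weilClasses_algebraic_of_prod_surface_all` (C. Schoen, *Addendum to: Hodge classes on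
self-products of a variety with an automorphism*, Compositio Math. 114 (1998) 329–336, §10
Proposition and its proof, pp. 332–333; E. Markman, arXiv:2509.23403 §11.5 Step 2; K. Koike,
Canad. Math. Bull. 47 (2004), Rem. 2.1). Everything here is PROVED; no definition and no named fact
is introduced. STATUS (2026-08-16): the fact is DISCHARGED — `Schoen1998_weilClasses_algebraic_of_prod_surface_all_holds`,
file `WeilClassesDescendingTransfer` — since the re-cut under which its Weil-type witness carries
Schoen's descent partner `t` (an algebraic class with `u± ⌣ t ≠ 0`, which Schoen constructs together
with `A'`, p. 333). This file is the earlier road for a witness given WITHOUT `t`: it reduces that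
form to ONE named fact of the layer, Lefschetz's theorem on `(1,1)`-classes
(`lefschetzOneOne_rational`, file `LefschetzOneOne`) —
`Schoen1998_weilClasses_algebraic_of_prod_surface_all_of_lefschetzOneOne` — removing the second
input (the Hodge index theorem `hodgeIndex_surface`, or the perfect pairing
`hodgeClasses_cupPairing_nondegenerate 2`) that `WeilClassesDescendingTransfer` granted; its
exterior-algebra lemmas (`E₊ ⌣ E₋ = H⁴ⁿ ≠ 0`, `E± ⌣ E± = 0`, `exists_algebraic_partner_of_algebraic`:
an ALGEBRAIC Weil class of a surface is its own descent partner) are how an explicit partner surface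
whose Weil class is a known divisor class (e.g. `E × E`, `WeilClassesSurfacesAlgebraic`) meets the
re-cut witness.

## The point

In Schoen's proof (§10, p. 333: "it is only necessary to show that the cup product
`W_{A×A'} ⊗ (H⁰(A) ⊗ W_{A'}) → W_A ⊗ H⁴(A') → W_A` is surjective … an explicit computation with
differential forms: `ω_{5,σ₁} ∧ ω_{6,σ₁} ∧ ω_{5,σ₂} ∧ ω_{6,σ₂}` is a basis for `H⁴(A'; ℂ)`") the
non-degeneracy needed on the partner surface `A'` is not the index theorem but the EXTERIOR-ALGEBRA
structure of the cohomology of an abelian variety: the two Weil lines `E₊ = ⋀²ⁿ V₊`,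
`E₋ = ⋀²ⁿ V₋` of `H²ⁿ(A(ℂ); ℂ) = ⋀²ⁿ(V₊ ⊕ V₋)` (van Geemen, LNM 1594, proof of Lemma 5.2 (6) and of
Thm. 6.12) multiply onto the top line, `⋀²ⁿ V₊ ∧ ⋀²ⁿ V₋ = ⋀⁴ⁿ H¹ = H⁴ⁿ ≠ 0`, and square to zero.
Since 2026-08-16 the tree PROVES `H•(A(ℂ); ℂ) = ⋀• H¹(A(ℂ); ℂ)` with `b₁ = 2 dim A`
(`Motives.abelianVarietyCohomologyExteriorH1_holds`, `Motives.AbelianVariety.hasExteriorCohomologyH1_complexPoints`,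
`Motives.AbelianVariety.finrank_complexBetti_one`; Lange–Birkenhake Lemma 1.1.17, Exercise 1.1.6
(7)–(8)) and that `E±` are LINES spanned by any non-zero member
(`finrank_weilClassesPlus_eq_one`, `weilClassesPlus_le_span_singleton`, file
`AbelianVarietyEndomorphismsHOne`). Hence, for the Weil-type witness `u = u₊ + u₋` of the partner
surface (`u± ≠ 0`), `u₊ ⌣ u₋ ≠ 0` and `u± ⌣ u± = 0`, so the partner divisor class of Schoen's proof
may be taken to be `t = u` ITSELF: `u₊ ⌣ u = u₊ ⌣ u₋ ≠ 0`, `u₋ ⌣ u = u₋ ⌣ u₊ = u₊ ⌣ u₋ ≠ 0` (graded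
commutativity in even degrees, Hatcher Thm. 3.11) — and `u` is algebraic by Lefschetz `(1,1)`
(Schoen: "`W_{A'}` is generated by cohomology classes of divisors"), the only named fact left.

## What is proved

* `cupPowOne_eq_cupProduct_split`, `cupProduct_cupPowOne_cupPowOne` — the iterated cup product of
  degree-one classes splits: `u₀ ⌣ ⋯ ⌣ u_{k-1} = (u₀ ⌣ ⋯ ⌣ u_{d-1}) ⌣ (u_d ⌣ ⋯ ⌣ u_{k-1})`
  (associativity and the unit; any topological space, any coefficient ring).
* `cupPowOne_basis_ne_zero` — if `H•(Y; ℂ) = ⋀• H¹(Y; ℂ)` (`HasExteriorCohomologyH1`) and `b` is a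
  basis of `H¹` indexed by `Fin N`, the top product `b₀ ⌣ ⋯ ⌣ b_{N-1}` is non-zero (it spans the
  line `H^N = ⋀^N H¹`: the iterated product is alternating, `Module.Basis.ext_alternating`).
* `cupPowOne_mem_pullbackEigenclasses` — a product of eigenvectors of `φ^*|_{H¹}` with eigenvalues
  `λᵢ` is a joint eigenclass of all the test endomorphisms `(x·𝟙 + y·φ)^*` of `WeilClasses` with
  character `∏ᵢ (x + y λᵢ)` (additivity `(x·𝟙 + y·φ)^* = x + y φ^*` on `H¹`,
  `complexBetti_map_nsmul_id_add_nsmul_one_of_mem_eigenspace`, and naturality `map_cupPowOne`).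
* `exists_weilLines_generators` — for `φ ≫ φ = -d`, `d ≥ 1`, `b₁ = 4n`, `n ≥ 1`: generators
  `P = ⌣ bp ∈ E₊`, `M = ⌣ bm ∈ E₋` (wedges of eigenbases of `V±`) with `P ⌣ M ≠ 0`,
  `P ⌣ P = 0 = M ⌣ M`; hence **`cupProduct_ne_zero_of_mem_weilClassesPlus_of_mem_weilClassesMinus`
  (`u₊ ⌣ u₋ ≠ 0` for non-zero `u± ∈ E±`)** and `cupProduct_self_eq_zero_of_mem_weilClassesPlus/Minus`.
* `exists_algebraic_partner_of_algebraic` — on a Weil-type abelian SURFACE, an ALGEBRAIC Weil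
  class `u = u₊ + u₋` (`u± ≠ 0`) is its own partner: `t = u` is algebraic with `u₊ ⌣ t ≠ 0`,
  `u₋ ⌣ t ≠ 0` (fact-free replacement of `exists_algebraic_partner_of_hodgeIndex_of_algebraic`).
* `Schoen1998_weilClasses_algebraic_of_prod_surface_all_of_weilClass_algebraic` — Schoen's
  Proposition for ONE Weil pair, UNCONDITIONAL given that the Weil class `u₊ + u₋` of the partner
  surface is algebraic (the shape in which a route supplies an explicit partner, e.g. `E × E` with
  its divisor class `weilDivisorClass`, file `WeilClassesSurfacesAlgebraic`).
* `Schoen1998_weilClasses_algebraic_of_prod_surface_all_of_surfaceWeilClasses_algebraic` — the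
  named fact GRANTED only that the rational `(1,1)` Weil class of every Weil-type abelian surface is
  algebraic; `Schoen1998_weilClasses_algebraic_of_prod_surface_all_of_lefschetzOneOne` — the named
  fact from `lefschetzOneOne_rational` alone (both ignore the descent partner now carried by the
  witness; kept as the Lefschetz road, superseded as a discharge by
  `Schoen1998_weilClasses_algebraic_of_prod_surface_all_holds`).

## References

* [Schoen1998HodgeWeilAddendum] C. Schoen, Addendum to: Hodge classes on self-products of a variety
  with an automorphism, Compositio Math. 114 (1998) 329–336, §10 (Proposition and proof, pp. 332–333).
* [Markman2025SurveySecant] E. Markman, Secant sheaves and Weil classes on abelian varieties,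
  arXiv:2509.23403, §11.5 Step 2.
* [Koike2004WeilHodge] K. Koike, Algebraicity of some Weil Hodge classes, Canad. Math. Bull. 47
  (2004), Rem. 2.1.
* [vanGeemen1994HodgeAV] B. van Geemen, An introduction to the Hodge conjecture for abelian
  varieties, LNM 1594 (1994), 4.9, proof of Lemma 5.2 (6), proof of Thm. 6.12.
* [LangeBirkenhake1992] H. Lange, Ch. Birkenhake, Complex Abelian Varieties (1992), Lemma 1.1.17,
  Exercise 1.1.6 (7)–(8).
* [Hatcher2002] A. Hatcher, Algebraic Topology (2002), §3.2 Prop. 3.10, Thm. 3.11, Example 3.16.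
* [VoisinHodgeI2002] C. Voisin, Hodge Theory and Complex Algebraic Geometry I, Thm. 11.30.
-/

noncomputable section

open CategoryTheory

universe u v

namespace Literature.AlgebraicGeometry.HodgeTheory

open Literature.AlgebraicTopology.SingularHomology

/-! ### Iterated cup products of degree-one classes: splitting, and the top product of a basis -/

section CupPowers

variable (R : Type v) [CommRing R] {Y : Type u} [TopologicalSpace Y]

/-- **Splitting an iterated product**: for `d + e = k` and `u : Fin k → H¹(Y; R)`,
`u₀ ⌣ ⋯ ⌣ u_{k-1} = (u₀ ⌣ ⋯ ⌣ u_{d-1}) ⌣ (u_d ⌣ ⋯ ⌣ u_{k-1})` — associativity of `⌣` and `1 ⌣ b = b`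
(Hatcher §3.2; the tree's `cupProduct_assoc`, `one_cupProduct`), by induction on `d`.
[cite: Hatcher2002, §3.2 Prop. 3.10 and p. 211] -/
theorem cupPowOne_eq_cupProduct_split (d e : ℕ) {k : ℕ} (h : d + e = k)
    (u : Fin k → singularCohomology R R Y 1) :
    cupPowOne R Y k u =
      cupProduct h (cupPowOne R Y d fun i => u (Fin.cast h (Fin.castAdd e i)))
        (cupPowOne R Y e fun j => u (Fin.cast h (Fin.natAdd d j))) := by
  induction d generalizing k with
  | zero =>
    obtain rfl : e = k := by omega
    rw [cupPowOne_zero, one_cupProduct]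
    congr 1
    funext j
    exact congrArg u (Fin.ext (by simp))
  | succ d ih =>
    obtain ⟨k, rfl⟩ : ∃ k', k = k' + 1 := ⟨k - 1, by omega⟩
    have h' : d + e = k := by omega
    -- the left block is `u 0` followed by the left block of `Fin.tail u`
    have hU₁ : (fun i : Fin (d + 1) => u (Fin.cast h (Fin.castAdd e i))) =
        Fin.cons (u 0) (fun i : Fin d => Fin.tail u (Fin.cast h' (Fin.castAdd e i))) := by
      funext i
      refine Fin.cases ?_ (fun i' => ?_) i
      · rw [Fin.cons_zero]
        exact congrArg u (Fin.ext (by simp))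
      · rw [Fin.cons_succ]
        exact congrArg u (Fin.ext (by simp))
    -- the right block is the right block of `Fin.tail u`
    have hU₂ : (fun j : Fin e => u (Fin.cast h (Fin.natAdd (d + 1) j))) =
        fun j : Fin e => Fin.tail u (Fin.cast h' (Fin.natAdd d j)) := by
      funext j
      exact congrArg u (Fin.ext (by simp; omega))
    rw [hU₁, hU₂, cupPowOne_succ, ih h' (Fin.tail u), ← cupProduct_cupPowOne,
      cupProduct_assoc (Nat.add_comm 1 d) h' h (Nat.add_comm 1 k)]

/-- **`(v₀ ⌣ ⋯ ⌣ v_{d-1}) ⌣ (w₀ ⌣ ⋯ ⌣ w_{e-1})` is the iterated product of the concatenated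
family** `Fin.append v w` (degree `d + e`). [cite: Hatcher2002, §3.2 p. 211] -/
theorem cupProduct_cupPowOne_cupPowOne {d e : ℕ} (v : Fin d → singularCohomology R R Y 1)
    (w : Fin e → singularCohomology R R Y 1) :
    cupProduct rfl (cupPowOne R Y d v) (cupPowOne R Y e w) =
      cupPowOne R Y (d + e) (Fin.append v w) := by
  rw [cupPowOne_eq_cupProduct_split R d e rfl (Fin.append v w)]
  simp only [Fin.cast_eq_self, Fin.append_left, Fin.append_right]

variable {R}

/-- **The top product of a basis of `H¹` is non-zero when `H•(Y; ℂ) = ⋀• H¹(Y; ℂ)`.** If every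
comparison map `⋀ᵈ H¹ → Hᵈ` is bijective (`HasExteriorCohomologyH1 ℂ Y`) and `b` is a basis of
`H¹(Y; ℂ)` indexed by `Fin N`, then `b₀ ⌣ ⋯ ⌣ b_{N-1} ≠ 0`: otherwise the ALTERNATING map
`m_N = cupPowOneAlt` vanishes on every injective family of basis vectors (a permutation of `b`,
`AlternatingMap.map_perm`), hence is zero (`Module.Basis.ext_alternating`), so `H^N`, which it spans
(`HasExteriorCohomologyH1.span_range_cupPowOne`), is `0` — but `dim H^N = (N choose N) = 1`. (For a
complex torus: `dz₁ ∧ dz̄₁ ∧ ⋯` generates `H^{2g}`; Lange–Birkenhake Exercise 1.1.6 (8).)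
[cite: LangeBirkenhake1992, Lemma 1.1.17 and Exercise 1.1.6 (7)–(8)] [cite: Hatcher2002, Example 3.16] -/
theorem cupPowOne_basis_ne_zero {N : ℕ} (hΛ : HasExteriorCohomologyH1 ℂ Y)
    (b : Module.Basis (Fin N) ℂ (singularCohomology ℂ ℂ Y 1)) :
    cupPowOne ℂ Y N b ≠ 0 := by
  classical
  intro h0
  haveI : Module.Finite ℂ (singularCohomology ℂ ℂ Y 1) := Module.Finite.of_basis b
  -- every iterated product of `N` degree-one classes vanishes
  have hzero : cupPowOneAlt ℂ Y N = 0 := by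
    refine b.ext_alternating fun v hv => ?_
    have hbij : Function.Bijective v := Finite.injective_iff_bijective.mp hv
    have e : (fun i => b (v i)) = (⇑b) ∘ (⇑(Equiv.ofBijective v hbij)) := rfl
    rw [AlternatingMap.zero_apply, e, AlternatingMap.map_perm, cupPowOneAlt_apply, h0, smul_zero]
  -- hence `H^N = 0`
  have htop : (⊤ : Submodule ℂ (singularCohomology ℂ ℂ Y N)) = ⊥ := by
    rw [← hΛ.span_range_cupPowOne N, Submodule.span_eq_bot]
    rintro _ ⟨v, rfl⟩
    rw [← cupPowOneAlt_apply, hzero, AlternatingMap.zero_apply]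
  -- but `dim H^N = 1`
  have hfr : Module.finrank ℂ (singularCohomology ℂ ℂ Y N) = 1 := by
    rw [hΛ.finrank_eq, Module.finrank_eq_card_basis b, Fintype.card_fin, Nat.choose_self]
  haveI : Nontrivial (singularCohomology ℂ ℂ Y N) := Module.nontrivial_of_finrank_eq_succ hfr
  obtain ⟨x, hx⟩ := exists_ne (0 : singularCohomology ℂ ℂ Y N)
  have hx' : x ∈ (⊥ : Submodule ℂ (singularCohomology ℂ ℂ Y N)) := by
    rw [← htop]
    exact Submodule.mem_top
  exact hx ((Submodule.mem_bot ℂ).mp hx')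

end CupPowers

/-! ### Products of eigenvectors of `φ^*` are joint eigenclasses -/

section Eigen

variable {A : Motives.AbelianVariety ℂ}

/-- **A product of eigenvectors of `φ^*|_{H¹}` is a joint eigenclass of every test endomorphism.**
If `vᵢ ∈ ker(φ^* - λᵢ) ⊆ H¹(A(ℂ); ℂ)` then `v₀ ⌣ ⋯ ⌣ v_{k-1}` lies in
`pullbackEigenclasses A φ k (∏ᵢ (x + y λᵢ))`: `(x·𝟙 + y·φ)^* vᵢ = (x + y λᵢ) vᵢ` (additivity of the
action on `H¹`, `complexBetti_map_nsmul_id_add_nsmul_one_of_mem_eigenspace`), `f^*` is multiplicative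
(`map_cupPowOne`) and `m_k` is multilinear. This is "`(x·𝟙 + y·φ)^*` acts on `⋀ᵃ V₊ ⊗ ⋀ᵇ V₋` by
`(x + iy√d)ᵃ (x - iy√d)ᵇ`" (module docstring of `WeilClasses`; van Geemen, proof of Thm. 6.12).
[cite: vanGeemen1994HodgeAV, 4.9 and proof of Thm. 6.12] -/
theorem cupPowOne_mem_pullbackEigenclasses {φ : A ⟶ A} {k : ℕ} {v : Fin k → complexBetti A.X 1}
    {lam : Fin k → ℂ}
    (hv : ∀ i, v i ∈ Module.End.eigenspace (complexBetti.map φ.hom.hom.hom 1).hom (lam i)) :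
    cupPowOne ℂ (Motives.ComplexPoints A.X) k v ∈
      pullbackEigenclasses A φ k fun x y => ∏ i, ((x : ℂ) + (y : ℂ) * lam i) := by
  rw [mem_pullbackEigenclasses_iff]
  intro x y
  rw [map_cupPowOne]
  have e : (fun i => singularCohomology.map ℂ ℂ
      (Motives.AlgPoints.mapContinuous (L := ℂ) (x • 𝟙 A + y • φ).hom.hom.hom) 1 (v i)) =
      fun i => ((x : ℂ) + (y : ℂ) * lam i) • v i := by
    funext i
    exact complexBetti_map_nsmul_id_add_nsmul_one_of_mem_eigenspace (hv i) x y
  rw [e, MultilinearMap.map_smul_univ]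

/-! ### The two Weil lines pair perfectly: `E₊ ⌣ E₋ ≠ 0`, `E± ⌣ E± = 0` -/

/-- **Generators of the two Weil lines and their products.** Let `φ ≫ φ = -(d • 𝟙 A)`, `d ≥ 1`,
`b₁(A) = 4n`, `n ≥ 1` (so `H¹ = V₊ ⊕ V₋`, `dim V± = 2n`, `isCompl_eigenspace_eigenspace_neg`,
`two_mul_finrank_eigenspace_eq`). For eigenbases `bp` of `V₊` and `bm` of `V₋`, the wedges
`P = ⌣ bp ∈ E₊ = weilClassesPlus A φ n d` and `M = ⌣ bm ∈ E₋` satisfy `P ⌣ M ≠ 0` — it is the top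
product of the basis `(bp, bm)` of `H¹`, non-zero as `H•(A(ℂ); ℂ) = ⋀• H¹`
(`Motives.AbelianVariety.hasExteriorCohomologyH1_complexPoints`, `cupPowOne_basis_ne_zero`) — and
`P ⌣ P = 0 = M ⌣ M` (a repeated degree-one factor, `cupPowOne_eq_zero_of_eq`). Van Geemen, proof of
Lemma 5.2 (6) and of Thm. 6.12: `E₊ = ⋀²ⁿ W'₊`, `E₋ = ⋀²ⁿ W'₋` inside `⋀²ⁿ(W'₊ ⊕ W'₋)`; Schoen §10:
"`ω_{5,σ₁} ∧ ω_{6,σ₁} ∧ ω_{5,σ₂} ∧ ω_{6,σ₂}` is a basis for `H⁴(A'; ℂ)`".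
[cite: vanGeemen1994HodgeAV, proof of Lemma 5.2 (6) and of Thm. 6.12]
[cite: Schoen1998HodgeWeilAddendum, §10 (proof of the Proposition, p. 333)]
[cite: LangeBirkenhake1992, Lemma 1.1.17 and Exercise 1.1.6 (7)–(8)] -/
theorem exists_weilLines_generators {n d : ℕ}
    (hb₁ : Module.finrank ℂ (complexBetti A.X 1) = 2 * (2 * n)) (hn : 0 < n) (hd : 0 < d)
    {φ : A ⟶ A} (hφ : φ ≫ φ = -(d • 𝟙 A)) :
    ∃ P M : complexBetti A.X (2 * n), P ∈ weilClassesPlus A φ n d ∧ M ∈ weilClassesMinus A φ n d ∧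
      cupProduct (rfl : 2 * n + 2 * n = 2 * n + 2 * n) P M ≠ 0 ∧
      cupProduct (rfl : 2 * n + 2 * n = 2 * n + 2 * n) P P = 0 ∧
      cupProduct (rfl : 2 * n + 2 * n = 2 * n + 2 * n) M M = 0 := by
  classical
  have hΛ : HasExteriorCohomologyH1 ℂ (Motives.ComplexPoints A.X) :=
    Motives.AbelianVariety.hasExteriorCohomologyH1_complexPoints A
  haveI := finite_complexBetti_abelianVariety A 1
  -- `H¹ = V₊ ⊕ V₋`, both of dimension `2n`
  have hp : Module.finrank ℂ (Module.End.eigenspace (complexBetti.map φ.hom.hom.hom 1).hom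
      (Complex.I * (Real.sqrt d : ℂ))) = 2 * n := by
    have h := two_mul_finrank_eigenspace_eq hd hφ
    rw [hb₁] at h
    omega
  have hq : Module.finrank ℂ (Module.End.eigenspace (complexBetti.map φ.hom.hom.hom 1).hom
      (-(Complex.I * (Real.sqrt d : ℂ)))) = 2 * n := by
    rw [← finrank_eigenspace_eq_finrank_eigenspace_neg hd hφ, hp]
  have hcompl := isCompl_eigenspace_eigenspace_neg hd hφ
  -- an eigenbasis of `H¹`, the `i√d`-vectors first
  let bp := Module.finBasisOfFinrankEq ℂ _ hp
  let bm := Module.finBasisOfFinrankEq ℂ _ hq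
  let b₀ : Module.Basis (Fin (2 * n) ⊕ Fin (2 * n)) ℂ (complexBetti A.X 1) :=
    (bp.prod bm).map (Submodule.prodEquivOfIsCompl _ _ hcompl)
  let b : Module.Basis (Fin (2 * n + 2 * n)) ℂ (complexBetti A.X 1) := b₀.reindex finSumFinEquiv
  have hb_left : ∀ i : Fin (2 * n), b (Fin.castAdd (2 * n) i) = (bp i : complexBetti A.X 1) := by
    intro i
    rw [Module.Basis.reindex_apply, finSumFinEquiv_symm_apply_castAdd]
    simp only [b₀, Module.Basis.map_apply, Module.Basis.prod_apply, Function.comp_apply,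
      LinearMap.inl_apply, Submodule.coe_prodEquivOfIsCompl', Submodule.coe_zero, add_zero, Sum.elim_inl]
  have hb_right : ∀ j : Fin (2 * n), b (Fin.natAdd (2 * n) j) = (bm j : complexBetti A.X 1) := by
    intro j
    rw [Module.Basis.reindex_apply, finSumFinEquiv_symm_apply_natAdd]
    simp only [b₀, Module.Basis.map_apply, Module.Basis.prod_apply, Function.comp_apply,
      LinearMap.inr_apply, Submodule.coe_prodEquivOfIsCompl', Submodule.coe_zero, zero_add, Sum.elim_inr]
  -- the two half-wedges `P = ⌣ᵢ b (castAdd i)`, `M = ⌣ⱼ b (natAdd j)`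
  let v : Fin (2 * n) → complexBetti A.X 1 := fun i => b (Fin.castAdd (2 * n) i)
  let w : Fin (2 * n) → complexBetti A.X 1 := fun j => b (Fin.natAdd (2 * n) j)
  have hvw : Fin.append v w = ⇑b := Fin.append_castAdd_natAdd
  have hv : ∀ i, v i ∈ Module.End.eigenspace (complexBetti.map φ.hom.hom.hom 1).hom
      (Complex.I * (Real.sqrt d : ℂ)) := fun i => by
    show b (Fin.castAdd (2 * n) i) ∈ _
    rw [hb_left]
    exact (bp i).2
  have hw : ∀ j, w j ∈ Module.End.eigenspace (complexBetti.map φ.hom.hom.hom 1).hom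
      (-(Complex.I * (Real.sqrt d : ℂ))) := fun j => by
    show b (Fin.natAdd (2 * n) j) ∈ _
    rw [hb_right]
    exact (bm j).2
  have hPgen := cupPowOne_mem_pullbackEigenclasses (A := A) (φ := φ) (v := v)
    (lam := fun _ => Complex.I * (Real.sqrt d : ℂ)) hv
  have hMgen := cupPowOne_mem_pullbackEigenclasses (A := A) (φ := φ) (v := w)
    (lam := fun _ => -(Complex.I * (Real.sqrt d : ℂ))) hw
  refine ⟨cupPowOne ℂ (Motives.ComplexPoints A.X) (2 * n) v,
    cupPowOne ℂ (Motives.ComplexPoints A.X) (2 * n) w, ?_, ?_, ?_, ?_, ?_⟩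
  · -- `P ∈ E₊`: character `∏ (x + y i√d) = (x + y i√d)²ⁿ`
    rw [mem_weilClassesPlus_iff]
    intro x y
    rw [(mem_pullbackEigenclasses_iff.mp hPgen) x y]
    show (∏ _i : Fin (2 * n), ((x : ℂ) + (y : ℂ) * (Complex.I * (Real.sqrt d : ℂ)))) • _ = _
    rw [Finset.prod_const, Finset.card_univ, Fintype.card_fin, mul_assoc]
  · -- `M ∈ E₋`: character `∏ (x - y i√d) = (x - y i√d)²ⁿ`
    rw [mem_weilClassesMinus_iff]
    intro x y
    rw [(mem_pullbackEigenclasses_iff.mp hMgen) x y]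
    show (∏ _i : Fin (2 * n), ((x : ℂ) + (y : ℂ) * -(Complex.I * (Real.sqrt d : ℂ)))) • _ = _
    rw [Finset.prod_const, Finset.card_univ, Fintype.card_fin, mul_neg, ← sub_eq_add_neg, mul_assoc]
  · -- `P ⌣ M` is the top product of the basis `b`
    rw [cupProduct_cupPowOne_cupPowOne, hvw]
    exact cupPowOne_basis_ne_zero hΛ b
  · -- `P ⌣ P = 0`: the factor `v 0` is repeated
    rw [cupProduct_cupPowOne_cupPowOne]
    refine cupPowOne_eq_zero_of_eq _ _ (Fin.castAdd (2 * n) ⟨0, by omega⟩)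
      (Fin.natAdd (2 * n) ⟨0, by omega⟩) ?_ ?_
    · rw [Fin.append_left, Fin.append_right]
    · intro h
      have h' := congrArg Fin.val h
      simp only [Fin.val_castAdd, Fin.val_natAdd] at h'
      omega
  · -- `M ⌣ M = 0`
    rw [cupProduct_cupPowOne_cupPowOne]
    refine cupPowOne_eq_zero_of_eq _ _ (Fin.castAdd (2 * n) ⟨0, by omega⟩)
      (Fin.natAdd (2 * n) ⟨0, by omega⟩) ?_ ?_
    · rw [Fin.append_left, Fin.append_right]
    · intro h
      have h' := congrArg Fin.val h
      simp only [Fin.val_castAdd, Fin.val_natAdd] at h'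
      omega

/-- **`u₊ ⌣ u₋ ≠ 0` for non-zero `u₊ ∈ E₊`, `u₋ ∈ E₋`** (`E± = weilClassesPlus/Minus A φ n d`,
`φ ≫ φ = -(d • 𝟙 A)`, `d ≥ 1`, `b₁(A) = 4n`, `n ≥ 1`; any target degree `k = 2n + 2n`): the two Weil
lines `⋀²ⁿ V₊`, `⋀²ⁿ V₋` multiply ONTO the top line `⋀⁴ⁿ H¹ = H⁴ⁿ(A(ℂ); ℂ)`. Indeed `E±` are lines
(`weilClassesPlus_le_span_singleton`, `weilClassesMinus_le_span_singleton`), so `u₊ = α P`,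
`u₋ = β M` with `α β ≠ 0` for the generators of `exists_weilLines_generators`, and `P ⌣ M ≠ 0`. This
is the non-degeneracy behind Schoen's "the cup product … is surjective" (§10), obtained here from
`H•(A(ℂ)) = ⋀• H¹` instead of the Hodge index theorem.
[cite: vanGeemen1994HodgeAV, proof of Lemma 5.2 (6) and of Thm. 6.12]
[cite: Schoen1998HodgeWeilAddendum, §10 (proof of the Proposition, p. 333)] -/
theorem cupProduct_ne_zero_of_mem_weilClassesPlus_of_mem_weilClassesMinus {n d : ℕ}
    (hb₁ : Module.finrank ℂ (complexBetti A.X 1) = 2 * (2 * n)) (hn : 0 < n) (hd : 0 < d)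
    {φ : A ⟶ A} (hφ : φ ≫ φ = -(d • 𝟙 A)) {k : ℕ} (hk : 2 * n + 2 * n = k)
    {up um : complexBetti A.X (2 * n)} (hup : up ∈ weilClassesPlus A φ n d)
    (hum : um ∈ weilClassesMinus A φ n d) (hup0 : up ≠ 0) (hum0 : um ≠ 0) :
    cupProduct hk up um ≠ 0 := by
  subst hk
  have hΛ : HasExteriorCohomologyH1 ℂ (Motives.ComplexPoints A.X) :=
    Motives.AbelianVariety.hasExteriorCohomologyH1_complexPoints A
  obtain ⟨P, M, hPE, hME, hPM, -, -⟩ := exists_weilLines_generators hb₁ hn hd hφ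
  have hP0 : P ≠ 0 := fun h => hPM (by rw [h, LinearMap.map_zero₂])
  have hM0 : M ≠ 0 := fun h => hPM (by rw [h, LinearMap.map_zero])
  obtain ⟨α, rfl⟩ := Submodule.mem_span_singleton.mp
    (weilClassesPlus_le_span_singleton hΛ hb₁ hd hφ hPE hP0 hup)
  obtain ⟨β, rfl⟩ := Submodule.mem_span_singleton.mp
    (weilClassesMinus_le_span_singleton hΛ hb₁ hd hφ hME hM0 hum)
  have hα : α ≠ 0 := fun h => hup0 (by rw [h, zero_smul])
  have hβ : β ≠ 0 := fun h => hum0 (by rw [h, zero_smul])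
  rw [LinearMap.map_smul₂, map_smul]
  exact smul_ne_zero hα (smul_ne_zero hβ hPM)

/-- **`u₊ ⌣ u₊ = 0` for `u₊ ∈ E₊`** (`⋀²ⁿ V₊ ∧ ⋀²ⁿ V₊ = 0` in `⋀⁴ⁿ H¹`, `n ≥ 1`).
[cite: vanGeemen1994HodgeAV, proof of Thm. 6.12] -/
theorem cupProduct_self_eq_zero_of_mem_weilClassesPlus {n d : ℕ}
    (hb₁ : Module.finrank ℂ (complexBetti A.X 1) = 2 * (2 * n)) (hn : 0 < n) (hd : 0 < d)
    {φ : A ⟶ A} (hφ : φ ≫ φ = -(d • 𝟙 A)) {k : ℕ} (hk : 2 * n + 2 * n = k)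
    {up : complexBetti A.X (2 * n)} (hup : up ∈ weilClassesPlus A φ n d) :
    cupProduct hk up up = 0 := by
  subst hk
  have hΛ : HasExteriorCohomologyH1 ℂ (Motives.ComplexPoints A.X) :=
    Motives.AbelianVariety.hasExteriorCohomologyH1_complexPoints A
  obtain ⟨P, M, hPE, -, hPM, hPP, -⟩ := exists_weilLines_generators hb₁ hn hd hφ
  have hP0 : P ≠ 0 := fun h => hPM (by rw [h, LinearMap.map_zero₂])
  obtain ⟨α, rfl⟩ := Submodule.mem_span_singleton.mp
    (weilClassesPlus_le_span_singleton hΛ hb₁ hd hφ hPE hP0 hup)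
  rw [LinearMap.map_smul₂, map_smul, hPP, smul_zero, smul_zero]

/-- **`u₋ ⌣ u₋ = 0` for `u₋ ∈ E₋`** (`⋀²ⁿ V₋ ∧ ⋀²ⁿ V₋ = 0`, `n ≥ 1`).
[cite: vanGeemen1994HodgeAV, proof of Thm. 6.12] -/
theorem cupProduct_self_eq_zero_of_mem_weilClassesMinus {n d : ℕ}
    (hb₁ : Module.finrank ℂ (complexBetti A.X 1) = 2 * (2 * n)) (hn : 0 < n) (hd : 0 < d)
    {φ : A ⟶ A} (hφ : φ ≫ φ = -(d • 𝟙 A)) {k : ℕ} (hk : 2 * n + 2 * n = k)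
    {um : complexBetti A.X (2 * n)} (hum : um ∈ weilClassesMinus A φ n d) :
    cupProduct hk um um = 0 := by
  subst hk
  have hΛ : HasExteriorCohomologyH1 ℂ (Motives.ComplexPoints A.X) :=
    Motives.AbelianVariety.hasExteriorCohomologyH1_complexPoints A
  obtain ⟨P, M, -, hME, hPM, -, hMM⟩ := exists_weilLines_generators hb₁ hn hd hφ
  have hM0 : M ≠ 0 := fun h => hPM (by rw [h, LinearMap.map_zero])
  obtain ⟨β, rfl⟩ := Submodule.mem_span_singleton.mp
    (weilClassesMinus_le_span_singleton hΛ hb₁ hd hφ hME hM0 hum)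
  rw [LinearMap.map_smul₂, map_smul, hMM, smul_zero, smul_zero]

end Eigen

/-! ### The Weil class of a Weil-type surface is its own partner -/

/-- **An ALGEBRAIC Weil class of a Weil-type abelian surface is its own partner divisor class
(fact-free).** Let `(A, φ)` be a complex abelian SURFACE with `φ ≫ φ = -(d • 𝟙 A)`, `d ≥ 1`,
`u₊ ∈ E₊`, `u₋ ∈ E₋` (`weilClassesPlus/Minus A φ 1 d`) both non-zero, and suppose `u = u₊ + u₋` is
ALGEBRAIC (`u ∈ N¹ H²`; for the rational `(1,1)`-class `u` this is Lefschetz `(1,1)` — Schoen: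
"`W_{A'}` is generated by cohomology classes of divisors"). Then `t = u` is an algebraic class with
`u₊ ⌣ t ≠ 0` and `u₋ ⌣ t ≠ 0`: `u₊ ⌣ u = u₊ ⌣ u₋ ≠ 0` and `u₋ ⌣ u = u₋ ⌣ u₊ = u₊ ⌣ u₋`
(`cupProduct_ne_zero_of_mem_weilClassesPlus_of_mem_weilClassesMinus`,
`cupProduct_self_eq_zero_of_mem_weilClassesPlus/Minus`, graded commutativity
`cupProduct_gradedComm_holds` in even degrees), `b₁(A) = 4` by
`finrank_complexBetti_one_of_dim_eq_two`. This replaces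
`exists_algebraic_partner_of_hodgeIndex_of_algebraic` (file `WeilClassesDescendingTransfer`), which
needed the named fact `hodgeIndex_surface A.X`.
[cite: Schoen1998HodgeWeilAddendum, §10 (proof of the Proposition, p. 333)]
[cite: vanGeemen1994HodgeAV, proof of Lemma 5.2 (6)] [cite: Hatcher2002, Thm. 3.11] -/
theorem exists_algebraic_partner_of_algebraic {A : Motives.AbelianVariety ℂ} {φ : A ⟶ A} {d : ℕ}
    (hd : 0 < d) (hA : A.dim = 2) (hφ : φ ≫ φ = -(d • 𝟙 A)) {up um : complexBetti A.X (2 * 1)}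
    (hup : up ∈ weilClassesPlus A φ 1 d) (hum : um ∈ weilClassesMinus A φ 1 d) (hup0 : up ≠ 0)
    (hum0 : um ≠ 0) (hN : up + um ∈ algebraicClasses A.X 1) :
    ∃ t : complexBetti A.X (2 * 1), t ∈ algebraicClasses A.X 1 ∧
      cupProduct (show 2 * 1 + 2 * 1 = 2 * (2 * 1) from rfl) up t ≠ 0 ∧
      cupProduct (show 2 * 1 + 2 * 1 = 2 * (2 * 1) from rfl) um t ≠ 0 := by
  have hb₁ : Module.finrank ℂ (complexBetti A.X 1) = 2 * (2 * 1) :=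
    finrank_complexBetti_one_of_dim_eq_two hA
  have hk : 2 * 1 + 2 * 1 = 2 * (2 * 1) := rfl
  have hne := cupProduct_ne_zero_of_mem_weilClassesPlus_of_mem_weilClassesMinus hb₁ Nat.one_pos hd
    hφ hk hup hum hup0 hum0
  have hpp := cupProduct_self_eq_zero_of_mem_weilClassesPlus hb₁ Nat.one_pos hd hφ hk hup
  have hmm := cupProduct_self_eq_zero_of_mem_weilClassesMinus hb₁ Nat.one_pos hd hφ hk hum
  refine ⟨up + um, hN, ?_, ?_⟩
  · rw [map_add, hpp, zero_add]
    exact hne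
  · rw [map_add, hmm, add_zero,
      cupProduct_gradedComm_holds ℂ (Motives.ComplexPoints A.X) hk hk um up]
    norm_num
    exact hne

/-! ### The named fact from Lefschetz `(1,1)` alone -/

/-- **`Schoen1998_weilClasses_algebraic_of_prod_surface_all` holds GRANTED only that the rational
`(1,1)` Weil class `u₊ + u₋` of every Weil-type complex abelian surface `(A₂, φ₂)` (`φ₂ ≫ φ₂ = -d`,
`A₂` smooth projective of dimension `2`) is ALGEBRAIC** — Lefschetz `(1,1)` for these classes, the
only place where Schoen's §10 proof ("`W_{A'}` is generated by cohomology classes of divisors") leaves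
the exterior algebra of `H•(A'; ℂ)`. Proof: the Weil-type witness `u = u₊ + u₋` of the partner
surface is its own partner divisor class (`exists_algebraic_partner_of_algebraic`: `u₊ ⌣ u ≠ 0`,
`u₋ ⌣ u ≠ 0` because `E₊ ⌣ E₋ = H⁴ ≠ 0` and `E± ⌣ E± = 0`), and Schoen's transfer for a given
partner (`Schoen1998_weilClasses_algebraic_of_prod_surface_all_of_partner`, file
`WeilClassesDescendingTransfer`: rational Weil projector upstairs, translation of divisors, Gysin
push-forward along `pr₁`, fibre integral `≠ 0`) concludes in every even dimension `2n`.
[cite: Schoen1998HodgeWeilAddendum, §10 (Proposition and proof, pp. 332–333)]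
[cite: Markman2025SurveySecant, §11.5 Step 2] [cite: Koike2004WeilHodge, Rem. 2.1] -/
theorem Schoen1998_weilClasses_algebraic_of_prod_surface_all_of_surfaceWeilClasses_algebraic
    (hW : ∀ (A : Motives.AbelianVariety ℂ) (φ : A ⟶ A) (d : ℕ), 0 < d → A.dim = 2 * 1 →
      Motives.IsSmoothProjective (2 * 1) A.X → φ ≫ φ = -(d • 𝟙 A) →
      ∀ up um : complexBetti A.X (2 * 1), up ∈ weilClassesPlus A φ 1 d →
        um ∈ weilClassesMinus A φ 1 d → IsRationalClass (up + um) →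
        IsOfHodgeType (2 * 1) A.X (2 * 1) 1 1 (up + um) → up + um ∈ algebraicClasses A.X 1) :
    Schoen1998_weilClasses_algebraic_of_prod_surface_all := by
  intro n hn d hd A₁ φ₁ A₂ φ₂ _ hA₁ _ hA₂dim hA₂ hφ₂ hwt hB c hc hcH hcW
  -- only `u₊ ≠ 0` is read off the witness (robust to trailing conjuncts of the Weil-type witness)
  obtain ⟨up, um, hup, hum, hr₂, hw₂, hup0, -⟩ := hwt
  -- `u = u₊ + u₋ ≠ 0` since `E₊ ⊓ E₋ = 0`, hence `u₋ = conj u₊ ≠ 0` (`ne_zero_of_isRationalClass_add`)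
  have h0 : up + um ≠ 0 := by
    intro h
    have hup' : up ∈ weilClassesMinus A₂ φ₂ 1 d := by
      rw [eq_neg_of_add_eq_zero_left h]
      exact Submodule.neg_mem _ hum
    exact hup0 (Submodule.disjoint_def.mp
      (disjoint_weilClassesPlus_weilClassesMinus A₂ φ₂ Nat.one_pos hd) up hup hup')
  obtain ⟨-, hum0⟩ := ne_zero_of_isRationalClass_add Nat.one_pos hd hup hum hr₂ h0
  -- Lefschetz `(1,1)` on the partner surface: `u = u₊ + u₋` is algebraic
  have hN : up + um ∈ algebraicClasses A₂.X 1 := hW A₂ φ₂ d hd hA₂dim hA₂ hφ₂ up um hup hum hr₂ hw₂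
  -- `u` is its own partner divisor class
  obtain ⟨t, htN, hpt, hmt⟩ := exists_algebraic_partner_of_algebraic hd hA₂dim hφ₂ hup hum hup0 hum0 hN
  exact Schoen1998_weilClasses_algebraic_of_prod_surface_all_of_partner hn hd φ₁ φ₂ hA₁ hA₂ hup hum
    hr₂ hw₂ htN hpt hmt hB hc hcH hcW

/-- **`Schoen1998_weilClasses_algebraic_of_prod_surface_all` holds GRANTED the single named fact
`lefschetzOneOne_rational`** (Lefschetz's theorem on `(1,1)`-classes, Voisin I Thm. 11.30; file
`LefschetzOneOne`): the rational `(1,1)` Weil class of the partner surface is algebraic by Lefschetz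
`(1,1)`, and `Schoen1998_weilClasses_algebraic_of_prod_surface_all_of_surfaceWeilClasses_algebraic`
concludes. Nothing else is assumed: the exterior-algebra structure of `H•(A₂(ℂ); ℂ)` with `b₁ = 4`
(`Motives.abelianVarietyCohomologyExteriorH1_holds`), the additivity of `End(A₂)` on `H¹`, Hodge
models, de Rham's theorem, Poincaré duality, Künneth spanning, Borel–Moore base change and the moving
of divisors on abelian varieties are THEOREMS of the tree. Discharging the named fact amounts to
discharging Lefschetz `(1,1)` (for Weil classes on Weil-type abelian surfaces):
`Schoen1998_weilClasses_algebraic_of_prod_surface_all_of_lefschetzOneOne lefschetzOneOne_rational_holds`.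
[cite: Schoen1998HodgeWeilAddendum, §10 (Proposition and proof, pp. 332–333)]
[cite: Markman2025SurveySecant, §11.5 Step 2] [cite: Koike2004WeilHodge, Rem. 2.1]
[cite: VoisinHodgeI2002, Thm. 11.30] -/
theorem Schoen1998_weilClasses_algebraic_of_prod_surface_all_of_lefschetzOneOne
    (hL : lefschetzOneOne_rational) : Schoen1998_weilClasses_algebraic_of_prod_surface_all :=
  Schoen1998_weilClasses_algebraic_of_prod_surface_all_of_surfaceWeilClasses_algebraic
    fun _ _ _ _ _ hA _ up um _ _ hr hw => hL hA (up + um) hr hw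

/-! ### Schoen's Proposition for one Weil pair with an algebraic partner Weil class (fact-free) -/

/-- **Schoen's transfer in every even dimension, for ONE Weil pair, from "the Weil class of the
partner surface is algebraic" — UNCONDITIONAL.** Let `n, d ≥ 1`, `(A₁, φ₁)` a complex abelian
variety smooth projective of dimension `2n`, `(A₂, φ₂)` a complex abelian SURFACE
(`A₂.dim = 2`, smooth projective of dimension `2`) with `φ₂ ≫ φ₂ = -(d • 𝟙 A₂)`, `u₊ ∈ E₊(A₂, φ₂)`,
`u₋ ∈ E₋(A₂, φ₂)` both non-zero with `u = u₊ + u₋` RATIONAL of Hodge type `(1,1)` and ALGEBRAIC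
(`u ∈ N¹ H²(A₂(ℂ); ℂ)` — Schoen's "`W_{A'}` is generated by cohomology classes of divisors"; for his
`A' = E × E` an explicit divisor class, cf. `weilDivisorClass_mem_algebraicClasses`, file
`WeilClassesSurfacesAlgebraic`; for an abstract Weil-type surface, Lefschetz `(1,1)`). IF every
rational `(n+1,n+1)`-class of the Weil plane of `(A₁ × A₂, φ₁ × φ₂)` is algebraic, THEN every
rational `(n,n)`-class of the Weil plane `weilClassesOf A₁ φ₁ n d` is algebraic: `u` is its own
partner divisor class (`exists_algebraic_partner_of_algebraic`: `u₊ ⌣ u ≠ 0`, `u₋ ⌣ u ≠ 0` from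
`E₊ ⌣ E₋ = H⁴ ≠ 0`, `E± ⌣ E± = 0`), and
`Schoen1998_weilClasses_algebraic_of_prod_surface_all_of_partner` (file
`WeilClassesDescendingTransfer`) concludes. No named fact is used.
[cite: Schoen1998HodgeWeilAddendum, §10 (Proposition and proof, pp. 332–333)]
[cite: Markman2025SurveySecant, §11.5 Step 2] [cite: Koike2004WeilHodge, Thm. 2.1 and Rem. 2.1] -/
theorem Schoen1998_weilClasses_algebraic_of_prod_surface_all_of_weilClass_algebraic
    {A₁ A₂ : Motives.AbelianVariety ℂ} {n d : ℕ} (hn : 0 < n) (hd : 0 < d) (φ₁ : A₁ ⟶ A₁)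
    (φ₂ : A₂ ⟶ A₂) (hA₁ : Motives.IsSmoothProjective (2 * n) A₁.X) (hA₂dim : A₂.dim = 2)
    (hA₂ : Motives.IsSmoothProjective (2 * 1) A₂.X) (hφ₂ : φ₂ ≫ φ₂ = -(d • 𝟙 A₂))
    {up um : complexBetti A₂.X (2 * 1)} (hup : up ∈ weilClassesPlus A₂ φ₂ 1 d)
    (hum : um ∈ weilClassesMinus A₂ φ₂ 1 d) (hup0 : up ≠ 0) (hum0 : um ≠ 0)
    (hr₂ : IsRationalClass (up + um)) (hw₂ : IsOfHodgeType (2 * 1) A₂.X (2 * 1) 1 1 (up + um))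
    (hN : up + um ∈ algebraicClasses A₂.X 1)
    (hB : ∀ c : complexBetti (A₁.prod A₂).X (2 * (n + 1)), IsRationalClass c →
      IsOfHodgeType (2 * (n + 1)) (A₁.prod A₂).X (2 * (n + 1)) (n + 1) (n + 1) c →
        c ∈ weilClassesOf (A₁.prod A₂)
          (Motives.AbelianVariety.prodLift (Motives.AbelianVariety.fst A₁ A₂ ≫ φ₁)
            (Motives.AbelianVariety.snd A₁ A₂ ≫ φ₂)) (n + 1) d →
        c ∈ algebraicClasses (A₁.prod A₂).X (n + 1))
    {c : complexBetti A₁.X (2 * n)} (hc : IsRationalClass c)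
    (hcH : IsOfHodgeType (2 * n) A₁.X (2 * n) n n c) (hcW : c ∈ weilClassesOf A₁ φ₁ n d) :
    c ∈ algebraicClasses A₁.X n := by
  obtain ⟨t, htN, hpt, hmt⟩ :=
    exists_algebraic_partner_of_algebraic hd hA₂dim hφ₂ hup hum hup0 hum0 hN
  exact Schoen1998_weilClasses_algebraic_of_prod_surface_all_of_partner hn hd φ₁ φ₂ hA₁ hA₂ hup hum
    hr₂ hw₂ htN hpt hmt hB hc hcH hcW

end Literature.AlgebraicGeometry.HodgeTheory

end
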